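import Summits.Schanuel.Schanuel.Theorems.DiophantineDichotomyApproximationPropertyCycleAPIAt3Defs
import Summits.Schanuel.Schanuel.Theorems.DiophantineDichotomyApproximationPropertyCycleAPIAt3GlueLemmas
import Summits.Schanuel.Schanuel.Theorems.DiophantineDichotomyApproximationPropertyCycleAPIAt3SatelliteHeightOrbitForms
import Summits.Schanuel.Schanuel.Theorems.DiophantineDichotomyApproximationPropertyCycleAPIAt3SatelliteHeightBezout
import HarnessLib

/-!
# Stub plan `CycleAPIAt3`, P3′: `stub_satelliteHeight : SatelliteHeight` (stmt-Schanuel-6117)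

Crux `stmt-Schanuel-6117` (`Summit.Schanuel.Schanuel.Theses.DiophantineDichotomy.ApproximationProperty`),
route `DiophantineDichotomy`, line `orbit-interpolation-determinant`, registered stub
`stub_satelliteHeight : SatelliteHeight` of the lead's skeleton (vocabulary
`DiophantineDichotomyApproximationPropertyCycleAPIAt3Defs.lean`, P3′, Tier 2: the input of the
bounded-degree satellite branch). This file PROVES it: **for every `δ ≥ 1` there is `C = C(δ)`
such that a `ℚ`-curve `V(𝔮) ⊂ ℙ³` (`𝔮` homogeneous prime of rank `2`, `deg 𝔮 = δ`) carrying a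
Galois orbit `V(𝔭)` (`𝔭 ⊇ 𝔮` homogeneous prime of rank `1`) of `D = deg 𝔭 > 2δ²` points has
`h(𝔮) ≤ C (h(𝔭)/D + 1)`** — the absolute normalisation `/D` being the point.

Proof (the curve is cut out, with controlled height, by the forms of low degree through the orbit):
* (Bézout, `orbit_form_mem_curve`) for `ν ≤ 2δ` a form of degree `ν` through the orbit lies in `𝔮`
  (`ν δ ≤ 2δ² < D`), so `𝔮_ν = 𝔭_ν`;
* (small forms, `orbit_small_forms`) `𝔭_ν` is spanned by forms of height `≤ C(ν)(h(𝔭)/D + 1)`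
  for every `ν` — an absolute Siegel lemma with basis over the compositum of the conjugate
  fields, through the non-vanishing of the discriminant and Cramer's rule with heights
  (`…SatelliteHeightConjugates/Cramer/OrbitForms.lean`);
* (two forms) the least degree `ν₁` of a form in `𝔮` is `≤ δ` (Hilbert-function count,
  `SatelliteHeightBezout.exists_form_of_degree`), a SMALL form `G₁ ∈ 𝔮_{ν₁}` exists (the small
  forms span `𝔮_{ν₁} ≠ 0`) and is irreducible (least degree), and a SMALL form `G₂ ∈ 𝔮_{2δ}`
  outside `(G₁)` exists (`exists_second_form`: `dim 𝔮_{2δ} > dim (G₁)_{2δ}`);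
* (elimination, `SatelliteHeightBezout.iheight_le_of_two_forms`) `𝔮` is a prime component of the
  cut of the prime surface `(G₁)` by `G₂`, so LNM 1752 Ch. 3 Prop. 4.8, 4.11, 4.7 give
  `h(𝔮) ≤ (h(G₁) + 9ν₁) 2δ + h(G₂) ν₁ + 42 ν₁ δ ≤ 60 δ² (C⋆ + 1)(h(𝔭)/D + 1)`,
  `C⋆ = ∑_{ν ≤ 2δ} C(ν)`.

Proofs only (no definitions, no named facts). Sources: NesterenkoPhilippon2001 (LNM 1752) Ch. 3
§4 (Prop. 4.7, 4.8, 4.11, 4.13), Ch. 10 Lemma 3.1–3.2; BombieriVaaler1983 Thm 9 and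
BombieriGubler2006 §2.9 for the shape of the small-forms lemma.
-/

noncomputable section

-- `Summit.Schanuel.Schanuel.…` is the mandated summit/sub-problem namespace (single-conjunct summit), hence:
set_option linter.dupNamespace false

namespace Summit.Schanuel.Schanuel.Cruxes.ApproximationProperty.OrbitInterpolationDeterminant

open Literature.NumberTheory.Transcendental Literature.NumberTheory.Transcendental.Nesterenko
open MvPolynomial
open scoped BigOperators

namespace SatelliteHeight

/-- The final arithmetic: with `A = C⋆(H + 1) ≥ h(G₁), h(G₂)`, `0 ≤ ν₁ ≤ δ`, `δ ≥ 1`,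
`(h(G₁) + 9ν₁) 2δ + h(G₂) ν₁ + 21 ν₁ (2δ) ≤ 60 δ² (C⋆ + 1)(H + 1)`. [folklore] -/
theorem final_arith {h₁ h₂ Cs H ν₁ δ : ℝ} (hCs : 0 ≤ Cs) (hH : 0 ≤ H)
    (hν₁ : 0 ≤ ν₁) (hν₁δ : ν₁ ≤ δ) (hδ : 1 ≤ δ) (hb₁ : h₁ ≤ Cs * (H + 1)) (hb₂ : h₂ ≤ Cs * (H + 1)) :
    (h₁ + 9 * ν₁) * (2 * δ) + h₂ * ν₁ + 21 * ν₁ * (2 * δ) ≤ 60 * δ ^ 2 * (Cs + 1) * (H + 1) := by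
  set A := Cs * (H + 1) with hA
  have hA0 : 0 ≤ A := mul_nonneg hCs (by linarith)
  have h1 : (h₁ + 9 * ν₁) * (2 * δ) ≤ (A + 9 * δ) * (2 * δ) :=
    mul_le_mul_of_nonneg_right (by linarith) (by linarith)
  have h2 : h₂ * ν₁ ≤ A * δ := mul_le_mul hb₂ hν₁δ hν₁ hA0
  have h3 : 21 * ν₁ * (2 * δ) ≤ 21 * δ * (2 * δ) :=
    mul_le_mul_of_nonneg_right (by linarith) (by linarith)
  have h4 : 3 * A * δ ≤ 60 * δ ^ 2 * A := by nlinarith [mul_nonneg hA0 (by linarith : (0 : ℝ) ≤ δ)]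
  have h5 : 60 * δ ^ 2 ≤ 60 * δ ^ 2 * (H + 1) := by nlinarith [sq_nonneg δ]
  have hexp : 60 * δ ^ 2 * (Cs + 1) * (H + 1) = 60 * δ ^ 2 * A + 60 * δ ^ 2 * (H + 1) := by
    rw [hA]; ring
  nlinarith [h1, h2, h3, h4, h5, hexp]

end SatelliteHeight

open SatelliteHeight in
/-- **P3′ `SatelliteHeight`** (registered stub `stub_satelliteHeight`): a `ℚ`-curve `V(𝔮) ⊂ ℙ³` of
degree `δ` carrying a Galois orbit of `D > 2δ²` points has `h(𝔮) ≤ C(δ) (h(𝔭)/D + 1)` — the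
curve is cut out by two SMALL forms through the orbit (an irreducible one of least degree `≤ δ`
and one of degree `2δ` prime to it), the forms through the orbit being small by the absolute
Siegel lemma `orbit_small_forms`, and the height of a prime component of the cut of a prime
surface by a form is controlled by LNM 1752 Ch. 3 Prop. 4.7, 4.8, 4.11.
[cite: NesterenkoPhilippon2001, Ch. 3 Prop. 4.7, 4.8, 4.11 (pp. 39–41)] -/
theorem stub_satelliteHeight : SatelliteHeight := by
  intro δ hδ
  classical
  letI := MvPolynomial.gradedAlgebra (σ := Fin (3 + 1)) (R := ℚ)
  -- the constants of the small-forms lemma in all degrees `ν ≤ 2δ`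
  have hex : ∀ ν : ℕ, ∃ C : ℝ, 0 < C ∧ (1 ≤ ν → ∀ 𝔭 : Ideal (Rx 3), 𝔭.IsPrime →
      𝔭.IsHomogeneous (homogeneousSubmodule (Fin (3 + 1)) ℚ) → IsUnmixedOfRank 𝔭 1 →
      ∃ s : Finset (Rx 3), (∀ G ∈ s, G ∈ 𝔭 ∧ G.IsHomogeneous ν ∧
        height G ≤ C * (iheight 𝔭 1 / ideg 𝔭 1 + 1)) ∧
        ∀ G ∈ 𝔭, G.IsHomogeneous ν → G ∈ Submodule.span ℚ (s : Set (Rx 3))) := by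
    intro ν
    by_cases hν : 1 ≤ ν
    · obtain ⟨C, hC, h⟩ := orbit_small_forms 3 ν (by norm_num) hν
      exact ⟨C, hC, fun _ => h⟩
    · exact ⟨1, one_pos, fun h => absurd h hν⟩
  choose Cf hCf_pos hCf using hex
  set Cs : ℝ := ∑ ν ∈ Finset.range (2 * δ + 1), Cf ν with hCs_def
  have hCf_le : ∀ ν, ν ≤ 2 * δ → Cf ν ≤ Cs := fun ν hν =>
    Finset.single_le_sum (f := Cf) (fun ν _ => (hCf_pos ν).le) (Finset.mem_range.mpr (by omega))
  have hCs0 : 0 ≤ Cs := Finset.sum_nonneg fun ν _ => (hCf_pos ν).le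
  refine ⟨60 * (δ : ℝ) ^ 2 * (Cs + 1), by positivity, ?_⟩
  intro 𝔭 𝔮 h𝔭 h𝔭hom h𝔭unm h𝔮 h𝔮hom h𝔮unm hdeg hle hD
  -- basic facts on `𝔮`
  have hdim : ringKrullDim (Rx 3 ⧸ 𝔮) = (2 : ℕ) := SatelliteRestartGlue.rank_eq_two h𝔮 h𝔮unm
  have hω : (fun _ : Fin (3 + 1) => (1 : ℂ)) ≠ 0 := fun h => one_ne_zero (congrFun h 0)
  obtain ⟨β, hβ, -⟩ :=
    NesterenkoPhilippon2001_ch3_prop_4_13_holds 3 1 𝔭 le_rfl (by norm_num) h𝔭hom h𝔭unm _ hω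
  have hne : (projZeros 𝔮).Nonempty := ⟨β, PhilipponMain.projZeros_antitone hle hβ⟩
  -- Bézout: forms of degree `ν ≤ 2δ` through the orbit lie in `𝔮`
  have hmem : ∀ (ν : ℕ) (G : Rx 3), 1 ≤ ν → ν ≤ 2 * δ → G.IsHomogeneous ν → G ∈ 𝔭 → G ∈ 𝔮 := by
    intro ν G hν1 hν2 hG hG𝔭
    refine orbit_form_mem_curve 3 𝔭 𝔮 ν G (by norm_num) h𝔭 h𝔭hom h𝔭unm h𝔮 h𝔮hom h𝔮unm hle hν1 hG
      ?_ hG𝔭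
    have h1 : ideg 𝔮 2 * ν ≤ 2 * δ ^ 2 := by rw [hdeg]; nlinarith
    omega
  -- the least degree `ν₁ ≤ δ` of a form of `𝔮`
  obtain ⟨P, hP𝔮, hPhom, hP0⟩ := SatelliteHeightBezout.exists_form_of_degree h𝔮 h𝔮hom hdim hne
  obtain ⟨E, ν₁, hE𝔮, hE0, hEhom, hν₁, hmin⟩ :=
    SatelliteHeightBezout.exists_isLeastForm h𝔮.ne_top ⟨ideg 𝔮 2, P, hP𝔮, hP0, hPhom⟩
  have hν₁δ : ν₁ ≤ δ := by rw [← hdeg]; exact hmin P hP𝔮 hP0 _ hPhom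
  -- a small non-zero form `G₁` of degree `ν₁`: irreducible, in `𝔮`
  obtain ⟨s₁, hs₁, hspan₁⟩ := hCf ν₁ hν₁ 𝔭 h𝔭 h𝔭hom h𝔭unm
  have hEspan : E ∈ Submodule.span ℚ (s₁ : Set (Rx 3)) := hspan₁ E (hle hE𝔮) hEhom
  obtain ⟨G₁, hG₁s, hG₁0⟩ : ∃ G₁ ∈ s₁, G₁ ≠ 0 := by
    by_contra hall
    push Not at hall
    have h0 : Submodule.span ℚ (s₁ : Set (Rx 3)) = ⊥ :=
      Submodule.span_eq_bot.mpr fun G hG => hall G (Finset.mem_coe.mp hG)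
    rw [h0, Submodule.mem_bot] at hEspan
    exact hE0 hEspan
  obtain ⟨hG₁𝔭, hG₁hom, hG₁h⟩ := hs₁ G₁ hG₁s
  have hG₁𝔮 : G₁ ∈ 𝔮 := hmem ν₁ G₁ hν₁ (by omega) hG₁hom hG₁𝔭
  have hG₁irr : Irreducible G₁ :=
    SatelliteHeightBezout.irreducible_of_isLeastForm h𝔮 hG₁𝔮 hG₁0 hG₁hom hmin
  have hP₁ : (Ideal.span {G₁}).IsPrime := (Ideal.span_singleton_prime hG₁0).mpr hG₁irr.prime
  -- a small form `G₂` of degree `2δ` outside `(G₁)`, in `𝔮`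
  obtain ⟨s₂, hs₂, hspan₂⟩ := hCf (2 * δ) (by omega) 𝔭 h𝔭 h𝔭hom h𝔭unm
  have hspan₂' : ∀ Q ∈ 𝔮, Q.IsHomogeneous (2 * ideg 𝔮 2) →
      Q ∈ Submodule.span ℚ (s₂ : Set (Rx 3)) := fun Q hQ hQh =>
    hspan₂ Q (hle hQ) (by rw [hdeg] at hQh; exact hQh)
  obtain ⟨G₂, hG₂s, hG₂n⟩ := SatelliteHeightBezout.exists_second_form h𝔮 h𝔮hom hdim hne hG₁hom hν₁
    (by rw [hdeg]; omega) hG₁0 hspan₂'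
  obtain ⟨hG₂𝔭, hG₂hom, hG₂h⟩ := hs₂ G₂ hG₂s
  have hG₂𝔮 : G₂ ∈ 𝔮 := hmem (2 * δ) G₂ (by omega) le_rfl hG₂hom hG₂𝔭
  -- the height of `𝔮` from the two forms
  have key := SatelliteHeightBezout.iheight_le_of_two_forms h𝔮 h𝔮unm hne hG₁hom hG₁0 hP₁ hG₁𝔮
    hG₂hom (by omega) hG₂𝔮 hG₂n
  -- arithmetic
  set H : ℝ := iheight 𝔭 1 / ideg 𝔭 1 with hH_def
  have hDpos : (0 : ℝ) < ideg 𝔭 1 := by exact_mod_cast (by omega : 0 < ideg 𝔭 1)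
  have hH0 : 0 ≤ H := div_nonneg (height_nonneg _) hDpos.le
  have hb₁ : height G₁ ≤ Cs * (H + 1) :=
    hG₁h.trans (mul_le_mul_of_nonneg_right (hCf_le ν₁ (by omega)) (by linarith))
  have hb₂ : height G₂ ≤ Cs * (H + 1) :=
    hG₂h.trans (mul_le_mul_of_nonneg_right (hCf_le (2 * δ) le_rfl) (by linarith))
  have hν₁R : (ν₁ : ℝ) ≤ δ := by exact_mod_cast hν₁δ
  have hδR : (1 : ℝ) ≤ δ := by exact_mod_cast hδ
  have hfin := final_arith hCs0 hH0 (Nat.cast_nonneg ν₁) hν₁R hδR hb₁ hb₂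
  push_cast at key
  linarith [key, hfin]

end Summit.Schanuel.Schanuel.Cruxes.ApproximationProperty.OrbitInterpolationDeterminant

end
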